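import Mathlib.Analysis.Real.Cardinality
import Literature.ModelTheory.ExponentialFields.SemialgebraicC1TriangulationProofs
import Literature.NumberTheory.Transcendental.KZPeriods

/-!
# Route StandardParts — crux `SpArcClosure`, line `registered`: rigidity of semialgebraic families
with `ℚ`-semialgebraic fibres (`stub_arcRigidity`)

Problem `KontsevichZagierPeriods`, route `StandardParts`, crux stmt-KontsevichZagierPeriods-3153
(`SpArcClosure`), skeleton `Cruxes/SpArcClosure/Lines/birth.lean`, stub `stub_arcRigidity` (the
load-bearing stub): a family of sets `D t ⊆ ℝⁿ` and functions `f t` on them, `t ∈ (0,1)`, whose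
total set `{(x,t) | t ∈ (0,1), x ∈ D t}` and total function `(x,t) ↦ f t x` are `ℚ`-semialgebraic
and ALL of whose fibres `D t`, `f t|_{D t}` are `ℚ`-semialgebraic, is CONSTANT on some `(0, ε)`.

Proof (elementary definability; the remark recorded in the design notes of
`Literature/NumberTheory/Transcendental/KZMoveFamily.lean` and by the route-review refuters on the
item, made formal).
1. `setFamily_eventually_const` — the set version for a family `G t ⊆ ℝᵐ`. There are countably
   many `ℚ`-semialgebraic subsets of `ℝᵐ` (`countable_setOf_isSemialgebraic`, tree). For each of
   them, `φ`, the level set `L_φ = {t ∈ (0,1) | G t = φ}` is a real-semialgebraic subset of the line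
   (Tarski–Seidenberg: the tree's definability kit `sa_*` and `sa_forall_block`), hence has finitely
   many "bad" points (points of `L_φ` of which `L_φ` is not a neighbourhood; o-minimality on the
   line, `exists_finset_Ioo_subset_or_disjoint`). The jump set
   `J = {t ∈ (0,1) | G is not locally constant at t}` is real-semialgebraic (same kit) and every
   `t ∈ J` is a bad point of `L_{G t}` (this is where the fibre hypothesis enters), so `J` is
   countable; a countable semialgebraic subset of the line contains no interval, so `J` misses some
   `(0, c)` (`eventually_nhdsGT_mem_or` at `0`), and a family locally constant on the connected set
   `(0, ε)` is constant there (`FibreLength.subset_or_disjoint_of_isPreconnected`).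
2. `stub_arcRigidity` — apply 1 in `ℝⁿ⁺¹` to the GRAPH family
   `G t = {(x, y) | x ∈ D t, y = f t x}`, whose total set is the total graph of `f` with the last
   two coordinates swapped (`IsSemialgebraic.preimage_comp`) and whose fibres are the graphs of the
   `f t` (`isSemialgebraicFunOn_iff`); equality of graphs gives equality of domains and of the
   functions on them.

Sources: L. van den Dries, *Tame Topology and O-minimal Structures* (1998), Ch. 1 (3.2)–(3.3),
Ch. 2 (the real field is o-minimal); J. Bochnak, M. Coste, M.-F. Roy, *Real Algebraic Geometry*
(1998), Thm. 2.2.1, Prop. 2.2.4 (Tarski–Seidenberg, first-order definability). Not here: anything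
about integrals or the KZ moves (the other stub and the composition live in the skeleton).
-/

noncomputable section

open Set Filter
open scoped Topology

namespace Summit.KontsevichZagierPeriods.StandardParts

open Literature.ModelTheory.ExponentialFields
open Literature.NumberTheory.Transcendental
open Literature.NumberTheory.Transcendental.SemialgebraicMonotonicity

/-! ### Two more pieces of the definability kit -/

/-- Equivalence of two real-semialgebraic conditions is real-semialgebraic.
[cite: BochnakCosteRoy1998, Prop. 2.2.4] -/
theorem sa_iff {N : ℕ} {P Q : (Fin N → ℝ) → Prop} (hP : IsSemialgebraic ℝ {z | P z})
    (hQ : IsSemialgebraic ℝ {z | Q z}) : IsSemialgebraic ℝ {z | P z ↔ Q z} := by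
  convert sa_and (sa_imp hP hQ) (sa_imp hQ hP) using 1
  ext z
  simp only [mem_setOf_eq]
  exact iff_iff_implies_and_implies

/-- Membership of a sub-tuple of coordinates in a fixed real-semialgebraic set is a
real-semialgebraic condition (preimage under a coordinate map). [cite: BochnakCosteRoy1998, §2.1] -/
theorem sa_mem_tuple {m N : ℕ} {φ : Set (Fin m → ℝ)} (hφ : IsSemialgebraic ℝ φ) (v : Fin m → Fin N) :
    IsSemialgebraic ℝ {w : Fin N → ℝ | (fun j => w (v j)) ∈ φ} :=
  hφ.preimage_comp v

/-! ### Rigidity of set families with `ℚ`-semialgebraic fibres -/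

section SetFamily

variable {m : ℕ}

/-- The guarded membership atom of a family: from the real-semialgebraic total set
`{z | z last ∈ (0,1) ∧ init z ∈ G (z last)}`, the condition
`w i ∈ (0,1) ∧ (w ∘ v) ∈ G (w i)` on `ℝᴺ` is real-semialgebraic for any choice of a parameter
coordinate `i` and space coordinates `v`. [cite: BochnakCosteRoy1998, §2.1] -/
theorem sa_family_atom {G : ℝ → Set (Fin m → ℝ)}
    (hS : IsSemialgebraic ℝ {z : Fin (m + 1) → ℝ |
      z (Fin.last m) ∈ Ioo (0:ℝ) 1 ∧ Fin.init z ∈ G (z (Fin.last m))})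
    {N : ℕ} (i : Fin N) (v : Fin m → Fin N) :
    IsSemialgebraic ℝ {w : Fin N → ℝ | w i ∈ Ioo (0:ℝ) 1 ∧ (fun j => w (v j)) ∈ G (w i)} := by
  have h := hS.preimage_comp (Fin.snoc (α := fun _ => Fin N) v i)
  convert h using 1
  ext w
  simp only [mem_setOf_eq, mem_preimage, Function.comp_apply, Fin.snoc_last]
  constructor
  · rintro ⟨h1, h2⟩
    refine ⟨h1, ?_⟩
    convert h2 using 1
    funext j
    simp [Fin.init, Fin.snoc_castSucc]
  · rintro ⟨h1, h2⟩
    refine ⟨h1, ?_⟩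
    convert h2 using 1
    funext j
    simp [Fin.init, Fin.snoc_castSucc]

/-- **Level sets are definable.** For a real-semialgebraic `φ ⊆ ℝᵐ`, the set of parameters
`t ∈ (0,1)` whose fibre is `φ` — written as the first-order condition
`∀ x, ((t ∈ (0,1) ∧ x ∈ G t) ↔ (t ∈ (0,1) ∧ x ∈ φ))` — is a real-semialgebraic subset of the
line (Tarski–Seidenberg, block quantifier over `x ∈ ℝᵐ`). [cite: BochnakCosteRoy1998, Prop. 2.2.4] -/
theorem sa_levelSet {G : ℝ → Set (Fin m → ℝ)}
    (hS : IsSemialgebraic ℝ {z : Fin (m + 1) → ℝ |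
      z (Fin.last m) ∈ Ioo (0:ℝ) 1 ∧ Fin.init z ∈ G (z (Fin.last m))})
    {φ : Set (Fin m → ℝ)} (hφ : IsSemialgebraic ℝ φ) :
    IsSemialgebraic ℝ {z : Fin 1 → ℝ | z 0 ∈ {t : ℝ | t ∈ Ioo (0:ℝ) 1 ∧
      ∀ x : Fin m → ℝ, ((t ∈ Ioo (0:ℝ) 1 ∧ x ∈ G t) ↔ (t ∈ Ioo (0:ℝ) 1 ∧ x ∈ φ))}} := by
  have key : IsSemialgebraic ℝ {z : Fin 1 → ℝ | z 0 ∈ Ioo (0:ℝ) 1 ∧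
      ∀ x : Fin m → ℝ, ((z 0 ∈ Ioo (0:ℝ) 1 ∧ x ∈ G (z 0)) ↔ (z 0 ∈ Ioo (0:ℝ) 1 ∧ x ∈ φ))} := by
    refine sa_and (sa_mem_Ioo 0 0 1) (sa_forall_block ?_)
    exact sa_iff (sa_family_atom hS (Fin.castAdd m 0) (Fin.natAdd 1))
      (sa_and (sa_mem_Ioo (Fin.castAdd m 0) 0 1) (sa_mem_tuple hφ (Fin.natAdd 1)))
  exact key

/-- **The jump set is definable.** The set of parameters `t ∈ (0,1)` at which the family is NOT
locally constant — the negation of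
`∃ c d, c < t < d ∧ ∀ s, (c < s < d ∧ s ∈ (0,1)) → ∀ x, ((s ∈ (0,1) ∧ x ∈ G s) ↔ (t ∈ (0,1) ∧ x ∈ G t))`
— is a real-semialgebraic subset of the line. [cite: BochnakCosteRoy1998, Prop. 2.2.4] -/
theorem sa_jumpSet {G : ℝ → Set (Fin m → ℝ)}
    (hS : IsSemialgebraic ℝ {z : Fin (m + 1) → ℝ |
      z (Fin.last m) ∈ Ioo (0:ℝ) 1 ∧ Fin.init z ∈ G (z (Fin.last m))}) :
    IsSemialgebraic ℝ {z : Fin 1 → ℝ | z 0 ∈ {t : ℝ | t ∈ Ioo (0:ℝ) 1 ∧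
      ¬ ∃ c d : ℝ, c < t ∧ t < d ∧ ∀ s : ℝ, (c < s ∧ s < d ∧ s ∈ Ioo (0:ℝ) 1) →
        ∀ x : Fin m → ℝ, ((s ∈ Ioo (0:ℝ) 1 ∧ x ∈ G s) ↔ (t ∈ Ioo (0:ℝ) 1 ∧ x ∈ G t))}} := by
  have key : IsSemialgebraic ℝ {z : Fin 1 → ℝ | z 0 ∈ Ioo (0:ℝ) 1 ∧
      ¬ ∃ c d : ℝ, c < z 0 ∧ z 0 < d ∧ ∀ s : ℝ, (c < s ∧ s < d ∧ s ∈ Ioo (0:ℝ) 1) →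
        ∀ x : Fin m → ℝ, ((s ∈ Ioo (0:ℝ) 1 ∧ x ∈ G s) ↔ (z 0 ∈ Ioo (0:ℝ) 1 ∧ x ∈ G (z 0)))} := by
    refine sa_and (sa_mem_Ioo 0 0 1) (sa_not (sa_exists (sa_exists ?_)))
    refine sa_and (sa_lt 1 0) (sa_and (sa_lt 0 2) (sa_forall ?_))
    refine sa_imp (sa_and (sa_lt 1 3) (sa_and (sa_lt 3 2) (sa_mem_Ioo 3 0 1))) (sa_forall_block ?_)
    exact sa_iff (sa_family_atom hS (Fin.castAdd m 3) (Fin.natAdd 4))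
      (sa_family_atom hS (Fin.castAdd m 0) (Fin.natAdd 4))
  exact key

/-- **Rigidity of semialgebraic set families with `ℚ`-semialgebraic fibres.** If the total set
`{(x,t) | t ∈ (0,1), x ∈ G t} ⊆ ℝᵐ⁺¹` is `ℚ`-semialgebraic and every fibre `G t`, `t ∈ (0,1)`, is
`ℚ`-semialgebraic, then `G` is constant on some `(0, ε)`. (Countably many candidate fibres; level
sets and the jump set are semialgebraic subsets of the line; the jump set is countable, hence avoids
a neighbourhood of `0⁺`; conclude by connectedness.)
[cite: Dries1998, Ch. 1 (3.2)–(3.3)] -/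
theorem setFamily_eventually_const (G : ℝ → Set (Fin m → ℝ))
    (hS : IsSemialgebraic ℚ {z : Fin (m + 1) → ℝ |
      z (Fin.last m) ∈ Ioo (0:ℝ) 1 ∧ Fin.init z ∈ G (z (Fin.last m))})
    (hfib : ∀ t ∈ Ioo (0:ℝ) 1, IsSemialgebraic ℚ (G t)) :
    ∃ ε ∈ Ioo (0:ℝ) 1, ∀ s ∈ Ioo (0:ℝ) ε, ∀ t ∈ Ioo (0:ℝ) ε, G s = G t := by
  have hSR := isSemialgebraic_real_of hS
  -- local constancy (within `(0,1)`) at a parameter `t`, in first-order form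
  set LC : ℝ → Prop := fun t => ∃ c d : ℝ, c < t ∧ t < d ∧
    ∀ s : ℝ, (c < s ∧ s < d ∧ s ∈ Ioo (0:ℝ) 1) →
      ∀ x : Fin m → ℝ, ((s ∈ Ioo (0:ℝ) 1 ∧ x ∈ G s) ↔ (t ∈ Ioo (0:ℝ) 1 ∧ x ∈ G t)) with hLC_def
  -- the jump set
  set J : Set ℝ := {t : ℝ | t ∈ Ioo (0:ℝ) 1 ∧ ¬ LC t} with hJ_def
  have hJ : IsSemialgebraic ℝ {z : Fin 1 → ℝ | z 0 ∈ J} := sa_jumpSet hSR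
  -- level sets and their finitely many bad points
  set L : Set (Fin m → ℝ) → Set ℝ := fun φ => {t : ℝ | t ∈ Ioo (0:ℝ) 1 ∧
    ∀ x : Fin m → ℝ, ((t ∈ Ioo (0:ℝ) 1 ∧ x ∈ G t) ↔ (t ∈ Ioo (0:ℝ) 1 ∧ x ∈ φ))} with hL_def
  have hL : ∀ φ : Set (Fin m → ℝ), IsSemialgebraic ℚ φ →
      ∃ F : Finset ℝ, ∀ p q : ℝ, (∀ x ∈ F, x ∉ Ioo p q) → Ioo p q ⊆ L φ ∨ Disjoint (Ioo p q) (L φ) :=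
    fun φ hφ => exists_finset_Ioo_subset_or_disjoint (sa_levelSet hSR (isSemialgebraic_real_of hφ))
  choose F hF using hL
  -- the jump set is countable: every jump parameter is a bad point of the level set of its fibre
  have hJsub : J ⊆ ⋃ (φ : Set (Fin m → ℝ)) (hφ : φ ∈ {φ | IsSemialgebraic ℚ φ}), (F φ hφ : Set ℝ) := by
    rintro t ⟨ht, hnot⟩
    simp only [mem_iUnion, Finset.mem_coe]
    refine ⟨G t, hfib t ht, ?_⟩
    by_contra htF
    obtain ⟨p, q, hpt, htq, hpq⟩ := exists_Ioo_forall_notMem_of_notMem (F (G t) (hfib t ht)) htF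
    have htL : t ∈ L (G t) := ⟨ht, fun x => Iff.rfl⟩
    rcases hF (G t) (hfib t ht) p q hpq with h | h
    · refine hnot ⟨p, q, hpt, htq, fun s hs x => ?_⟩
      have hsL := h ⟨hs.1, hs.2.1⟩
      exact ((hsL.2 x).trans (by exact ⟨fun h' => ⟨ht, h'.2⟩, fun h' => ⟨hs.2.2, h'.2⟩⟩))
    · exact (Set.disjoint_left.1 h ⟨hpt, htq⟩) htL
  have hJc : J.Countable :=
    ((countable_setOf_isSemialgebraic ℚ (Fin m)).biUnion
      fun φ hφ => (F φ hφ).finite_toSet.countable).mono hJsub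
  -- hence no jumps on some `(0, c)`
  obtain ⟨c, hc, hcJ⟩ : ∃ c : ℝ, 0 < c ∧ ∀ t ∈ Ioo (0:ℝ) c, t ∉ J := by
    rcases eventually_nhdsGT_mem_or hJ 0 with h | h
    · exfalso
      obtain ⟨c, hc, hsub⟩ := mem_nhdsGT_iff_exists_Ioo_subset.1 h
      have hcount : (Ioo (0:ℝ) c).Countable := hJc.mono hsub
      exact (lt_irrefl (0:ℝ)) (lt_of_lt_of_le hc (Cardinal.Real.Ioo_countable_iff.1 hcount))
    · obtain ⟨c, hc, hsub⟩ := mem_nhdsGT_iff_exists_Ioo_subset.1 h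
      exact ⟨c, hc, fun t ht => hsub ht⟩
  -- local constancy on `(0, ε)`, `ε = min c (1/2)`
  set ε : ℝ := min c (1/2) with hε_def
  have hε0 : 0 < ε := lt_min hc one_half_pos
  have hε1 : ε < 1 := (min_le_right _ _).trans_lt one_half_lt_one
  have hεc : ε ≤ c := min_le_left _ _
  have hloc : ∀ u ∈ Ioo (0:ℝ) ε, ∀ᶠ u' in 𝓝 u, G u' = G u := by
    intro u hu
    have hu1 : u ∈ Ioo (0:ℝ) 1 := ⟨hu.1, hu.2.trans hε1⟩
    have huJ : u ∉ J := hcJ u ⟨hu.1, hu.2.trans_le hεc⟩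
    have hLCu : LC u := by
      by_contra h'
      exact huJ ⟨hu1, h'⟩
    obtain ⟨c', d', hc'u, hud', H⟩ := hLCu
    filter_upwards [Ioo_mem_nhds hc'u hud', Ioo_mem_nhds hu1.1 hu1.2] with u' hu' hu'1
    ext x
    have := H u' ⟨hu'.1, hu'.2, hu'1⟩ x
    exact ⟨fun hx => (this.1 ⟨hu'1, hx⟩).2, fun hx => (this.2 ⟨hu1, hx⟩).2⟩
  refine ⟨ε, ⟨hε0, hε1⟩, fun s hs t ht => ?_⟩
  -- connectedness of `(0, ε)`
  have hkey := FibreLength.subset_or_disjoint_of_isPreconnected (F := {u | G u = G s})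
    isPreconnected_Ioo (fun u (hu : u ∈ Ioo (0:ℝ) ε) =>
      (hloc u hu).mono fun u' hu' => by rw [mem_setOf_eq, mem_setOf_eq, hu'])
  rcases hkey with h | h
  · exact (h ht).symm
  · exact absurd (Set.disjoint_left.1 h hs) (fun h' => h' rfl)

end SetFamily

/-! ### The stub: domains and integrands together, via the graph family -/

/-- **`stub_arcRigidity`** (skeleton `Cruxes/SpArcClosure/Lines/birth.lean`, registered signature):
a family `(D t, f t)`, `t ∈ (0,1)`, with `ℚ`-semialgebraic total set and total function and
`ℚ`-semialgebraic fibres is constant on some `(0, ε)` — domains equal and functions equal on them.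
Proof: `setFamily_eventually_const` applied in `ℝⁿ⁺¹` to the family of graphs
`{(x, y) | x ∈ D t, y = f t x}`. [cite: Dries1998, Ch. 1 (3.2)–(3.3)] -/
theorem stub_arcRigidity :
    ∀ ⦃n : ℕ⦄ (D : ℝ → Set (Fin n → ℝ)) (f : ℝ → (Fin n → ℝ) → ℝ),
      Literature.ModelTheory.ExponentialFields.IsSemialgebraic ℚ
          {z : Fin (n + 1) → ℝ | z (Fin.last n) ∈ Set.Ioo (0:ℝ) 1 ∧ Fin.init z ∈ D (z (Fin.last n))} →
      Literature.NumberTheory.Transcendental.IsSemialgebraicFunOn ℚ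
          {z : Fin (n + 1) → ℝ | z (Fin.last n) ∈ Set.Ioo (0:ℝ) 1 ∧ Fin.init z ∈ D (z (Fin.last n))}
          (fun z => f (z (Fin.last n)) (Fin.init z)) →
      (∀ t ∈ Set.Ioo (0:ℝ) 1, Literature.ModelTheory.ExponentialFields.IsSemialgebraic ℚ (D t)) →
      (∀ t ∈ Set.Ioo (0:ℝ) 1, Literature.NumberTheory.Transcendental.IsSemialgebraicFunOn ℚ (D t) (f t)) →
      ∃ ε ∈ Set.Ioo (0:ℝ) 1, ∀ s ∈ Set.Ioo (0:ℝ) ε, ∀ t ∈ Set.Ioo (0:ℝ) ε,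
        D s = D t ∧ Set.EqOn (f s) (f t) (D t) := by
  intro n D f _hD hF _hDt hft
  -- the graph family
  set G : ℝ → Set (Fin (n + 1) → ℝ) :=
    fun t => {u : Fin (n + 1) → ℝ | Fin.init u ∈ D t ∧ u (Fin.last n) = f t (Fin.init u)} with hG_def
  have hfibG : ∀ t ∈ Ioo (0:ℝ) 1, IsSemialgebraic ℚ (G t) :=
    fun t ht => isSemialgebraicFunOn_iff.mp (hft t ht)
  -- its total set is the total graph with the last two coordinates swapped
  have hΓ := isSemialgebraicFunOn_iff.mp hF
  set σ : Equiv.Perm (Fin (n + 2)) := Equiv.swap (Fin.castSucc (Fin.last n)) (Fin.last (n + 1))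
    with hσ_def
  have hSG : IsSemialgebraic ℚ {w : Fin (n + 1 + 1) → ℝ |
      w (Fin.last (n + 1)) ∈ Ioo (0:ℝ) 1 ∧ Fin.init w ∈ G (w (Fin.last (n + 1)))} := by
    convert hΓ.preimage_comp σ using 1
    ext w
    have h1 : σ (Fin.last (n + 1)) = Fin.castSucc (Fin.last n) := Equiv.swap_apply_right _ _
    have h2 : σ (Fin.castSucc (Fin.last n)) = Fin.last (n + 1) := Equiv.swap_apply_left _ _
    have h3 : ∀ i : Fin n, σ (Fin.castSucc (Fin.castSucc i)) = Fin.castSucc (Fin.castSucc i) :=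
      fun i => Equiv.swap_apply_of_ne_of_ne
        (fun h => (Fin.castSucc_lt_last i).ne (Fin.castSucc_injective _ h))
        (fun h => (Fin.castSucc_lt_last (Fin.castSucc i)).ne h)
    have hinit : Fin.init (Fin.init (w ∘ σ)) = Fin.init (Fin.init w) := by
      funext i
      simp only [Fin.init, Function.comp_apply, h3]
    simp only [mem_setOf_eq, mem_preimage, hG_def, Function.comp_apply, h1]
    constructor
    · rintro ⟨ht, hD, hy⟩
      refine ⟨⟨?_, ?_⟩, ?_⟩
      · simpa only [Fin.init, Function.comp_apply, h2] using ht
      · simpa only [hinit, Fin.init, Function.comp_apply, h2] using hD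
      · simpa only [hinit, Fin.init, Function.comp_apply, h2] using hy
    · rintro ⟨⟨ht, hD⟩, hy⟩
      refine ⟨?_, ?_, ?_⟩
      · simpa only [Fin.init, Function.comp_apply, h2] using ht
      · simpa only [hinit, Fin.init, Function.comp_apply, h2] using hD
      · simpa only [hinit, Fin.init, Function.comp_apply, h2] using hy
  obtain ⟨ε, hε, hG⟩ := setFamily_eventually_const G hSG hfibG
  refine ⟨ε, hε, fun s hs t ht => ?_⟩
  have hst := hG s hs t ht
  have key : ∀ x : Fin n → ℝ, ∀ y : ℝ, (x ∈ D s ∧ y = f s x) ↔ (x ∈ D t ∧ y = f t x) := by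
    intro x y
    have := Set.ext_iff.1 hst (Fin.snoc x y)
    simpa only [hG_def, mem_setOf_eq, Fin.init_snoc, Fin.snoc_last] using this
  refine ⟨?_, fun x hx => ?_⟩
  · ext x
    exact ⟨fun hx => ((key x (f s x)).1 ⟨hx, rfl⟩).1, fun hx => ((key x (f t x)).2 ⟨hx, rfl⟩).1⟩
  · exact (((key x (f t x)).2 ⟨hx, rfl⟩).2).symm

end Summit.KontsevichZagierPeriods.StandardParts
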